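import Literature.Probability.Percolation.CriticalContinuityProofs
import Literature.Probability.Percolation.PercolationProofs
import HarnessLib

/-!
# No percolation when `8p < 1 - t`
# (`stub_runBound` of line `locmod`, crux `CriticalCurveRegular`, stmt-CriticalPhenomena-16065)

Anisotropic bond percolation on `ℤ² × ℤ` driven by i.i.d. uniform labels `U_e`
(`labelMeasure (Site 3)`): a vertical bond `{x, x + e₂}` is open iff `U_e ≤ t`, a horizontal
bond iff `U_e ≤ p`. We prove `θ(p, t) = 0` whenever `0 ≤ t < 1`, `0 ≤ p` and `8p < 1 - t`, by
path counting with vertical runs (the anisotropic variant of Grimmett 1999, §1.4, (1.15)–(1.16)):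

* if the origin percolates, then for every `n` some word `w ∈ ({0,1,2} × {±})ⁿ` traverses `n`
  distinct open edges (`exists_openWord_of_infinite`);
* the `n` distinct edges of such a word are open with probability `p^{h} t^{n-h}`, `h` the number
  of horizontal letters (`Measure.infinitePi_pi`, `RunBound.cylinder_le`);
* a word traversing distinct edges has constant vertical runs, so the words with a given set `A`
  of horizontal positions are coded by the horizontal letters (`4^{|A|}`), the direction of the
  letter following each horizontal position (`2^{|A|}`) and the first direction (`2`): at most
  `2 · 8^{|A|}` of them (`RunBound.fiber_card_le`), whence the total weight is at most
  `∑_A 2 · 8^{|A|} p^{|A|} t^{n-|A|} = 2 (8p + t)ⁿ → 0` (`Fin.sum_pow_mul_eq_add_pow`).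

Source: G. Grimmett, *Percolation*, 2nd ed. (1999), §1.4 pp. 15–16.
-/

noncomputable section

open MeasureTheory Set
open Literature.Probability.Percolation Literature.Probability.LatticeModels

namespace Summit.CriticalPhenomena.PercolationContinuityZ3.Cruxes.CriticalCurveRegular.Locmod

namespace RunBound

/-! ### Geometry of step words on `ℤ³` -/

/-- The edge `{y, y + step a}` is a vertical bond `{x, x + e₂}` iff the letter `a` has
direction `2`. -/
theorem vert_iff (y : Site 3) (a : Fin 3 × Bool) :
    (∃ x : Site 3, s(y, y + stepVec a) = s(x, x + Pi.single (2 : Fin 3) 1)) ↔ a.1 = 2 := by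
  constructor
  · rintro ⟨x, hx⟩
    by_contra h
    have h2 : stepVec a 2 = 0 := by
      have h' : (2 : Fin 3) ≠ a.1 := fun h' => h h'.symm
      unfold stepVec
      split_ifs <;> simp [h']
    rw [Sym2.eq_iff] at hx
    rcases hx with ⟨rfl, h'⟩ | ⟨rfl, h'⟩
    · have := congrFun h' 2
      simp [h2] at this
    · have := congrFun h' 2
      simp [h2] at this
  · intro h
    obtain ⟨i, b⟩ := a
    simp only at h
    subst h
    cases b
    · refine ⟨y - Pi.single 2 1, ?_⟩
      rw [sub_add_cancel, Sym2.eq_swap]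
      simp [stepVec, sub_eq_add_neg]
    · exact ⟨y, by simp [stepVec]⟩

/-- In a word traversing `n` distinct edges, two consecutive vertical letters are equal
(otherwise the second step reverses the first and the two edges coincide). -/
theorem letter_eq_of_card {n : ℕ} (w : Fin n → Fin 3 × Bool)
    (hw : ((Finset.range n).image fun k => s(wordPos w k, wordPos w (k + 1))).card = n)
    (j : ℕ) (hj : j + 1 < n) (h1 : (w ⟨j, Nat.lt_of_succ_lt hj⟩).1 = 2)
    (h2 : (w ⟨j + 1, hj⟩).1 = 2) : w ⟨j, Nat.lt_of_succ_lt hj⟩ = w ⟨j + 1, hj⟩ := by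
  classical
  by_contra hne
  have hinj : Set.InjOn (fun k => s(wordPos w k, wordPos w (k + 1))) ↑(Finset.range n) :=
    Finset.card_image_iff.1 (by rw [hw, Finset.card_range])
  have key : ∀ a b : Fin 3 × Bool, a.1 = 2 → b.1 = 2 → a ≠ b →
      stepVec a + stepVec b = 0 := by
    rintro ⟨a1, a2⟩ ⟨b1, b2⟩ ha hb hab
    simp only at ha hb
    subst ha
    subst hb
    cases a2 <;> cases b2 <;> simp_all [stepVec]
  have hpos : wordPos w (j + 1 + 1) = wordPos w j := by
    rw [wordPos_succ w hj, wordPos_succ w (Nat.lt_of_succ_lt hj), add_assoc, key _ _ h1 h2 hne,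
      add_zero]
  have hj1 : j ∈ (↑(Finset.range n) : Set ℕ) := by simp; omega
  have hj2 : j + 1 ∈ (↑(Finset.range n) : Set ℕ) := by simp; omega
  have := hinj hj1 hj2 (show s(wordPos w j, wordPos w (j + 1)) =
      s(wordPos w (j + 1), wordPos w (j + 1 + 1)) by rw [hpos]; exact Sym2.eq_swap)
  omega

/-! ### The cylinder probability of a word -/

/-- The `n` distinct edges of a word are all open with probability at most `∏ₖ lvl(wₖ)`, where
`lvl = t` for a vertical and `lvl = p` for a horizontal letter (product measure: the event is
contained in the box `∏_{e} {U_e ≤ lvl e}` of `labelMeasure`-mass `∏_e lvl e`). -/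
theorem cylinder_le {n : ℕ} {p t : ℝ} (hp0 : 0 ≤ p) (hp1 : p ≤ 1) (ht0 : 0 ≤ t)
    (ht1 : t ≤ 1) (w : Fin n → Fin 3 × Bool)
    (hw : ((Finset.range n).image fun k => s(wordPos w k, wordPos w (k + 1))).card = n) :
    (labelMeasure (Site 3)).real
        {U | (↑((Finset.range n).image fun k => s(wordPos w k, wordPos w (k + 1))) :
              Set (Sym2 (Site 3))) ⊆
          {e | e ∈ (zdGraph 3).edgeSet ∧
            (((∃ x : Site 3, e = s(x, x + Pi.single (2 : Fin 3) 1)) ∧ U e ≤ t) ∨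
              (¬ (∃ x : Site 3, e = s(x, x + Pi.single (2 : Fin 3) 1)) ∧ U e ≤ p))}} ≤
      ∏ k : Fin n, (if (w k).1 = 2 then t else p) := by
  classical
  have := isProbabilityMeasure_labelMeasure (Site 3)
  set F : Finset (Sym2 (Site 3)) :=
    (Finset.range n).image fun k => s(wordPos w k, wordPos w (k + 1)) with hF
  obtain ⟨lvl, hlvl⟩ : ∃ lvl : Sym2 (Site 3) → ℝ,
      ∀ e, lvl e = if (∃ x : Site 3, e = s(x, x + Pi.single (2 : Fin 3) 1)) then t else p :=
    ⟨_, fun _ => rfl⟩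
  have h01 : ∀ e, 0 ≤ lvl e ∧ lvl e ≤ 1 := by
    intro e
    rw [hlvl]
    split_ifs
    · exact ⟨ht0, ht1⟩
    · exact ⟨hp0, hp1⟩
  have hsub : {U : Sym2 (Site 3) → ℝ | (↑F : Set (Sym2 (Site 3))) ⊆
      {e | e ∈ (zdGraph 3).edgeSet ∧
        (((∃ x : Site 3, e = s(x, x + Pi.single (2 : Fin 3) 1)) ∧ U e ≤ t) ∨
          (¬ (∃ x : Site 3, e = s(x, x + Pi.single (2 : Fin 3) 1)) ∧ U e ≤ p))}} ⊆
      Set.pi (↑F) (fun e => Iic (lvl e)) := by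
    intro U hU e he
    have h := (hU he).2
    rw [mem_Iic, hlvl]
    rcases h with ⟨hv, hle⟩ | ⟨hv, hle⟩
    · rw [if_pos hv]; exact hle
    · rw [if_neg hv]; exact hle
  have hpi : (labelMeasure (Site 3)).real (Set.pi (↑F) fun e => Iic (lvl e)) =
      ∏ e ∈ F, lvl e := by
    have := isProbabilityMeasure_volume_restrict_unitInterval
    rw [measureReal_def, labelMeasure, Measure.infinitePi_pi _ (fun _ _ => measurableSet_Iic),
      ENNReal.toReal_prod]
    refine Finset.prod_congr rfl fun e _ => ?_
    rw [Measure.restrict_apply measurableSet_Iic]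
    have hI : Iic (lvl e) ∩ Icc (0 : ℝ) 1 = Icc 0 (lvl e) := by
      ext x
      simp only [mem_inter_iff, mem_Iic, mem_Icc]
      constructor
      · rintro ⟨h1, h2, -⟩; exact ⟨h2, h1⟩
      · rintro ⟨h1, h2⟩; exact ⟨h2, h1, h2.trans (h01 e).2⟩
    rw [hI, Real.volume_Icc, sub_zero, ENNReal.toReal_ofReal (h01 e).1]
  have hinj : Set.InjOn (fun k => s(wordPos w k, wordPos w (k + 1))) ↑(Finset.range n) :=
    Finset.card_image_iff.1 (by rw [hw, Finset.card_range])
  calc (labelMeasure (Site 3)).real {U : Sym2 (Site 3) → ℝ | (↑F : Set (Sym2 (Site 3))) ⊆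
        {e | e ∈ (zdGraph 3).edgeSet ∧
          (((∃ x : Site 3, e = s(x, x + Pi.single (2 : Fin 3) 1)) ∧ U e ≤ t) ∨
            (¬ (∃ x : Site 3, e = s(x, x + Pi.single (2 : Fin 3) 1)) ∧ U e ≤ p))}}
      ≤ (labelMeasure (Site 3)).real (Set.pi (↑F) fun e => Iic (lvl e)) := measureReal_mono hsub
    _ = ∏ e ∈ F, lvl e := hpi
    _ = ∏ k ∈ Finset.range n, lvl s(wordPos w k, wordPos w (k + 1)) := by
        rw [hF, Finset.prod_image fun x hx y hy h => hinj hx hy h]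
    _ = ∏ k : Fin n, lvl s(wordPos w k, wordPos w (k + 1)) :=
        (Fin.prod_univ_eq_prod_range (fun k => lvl s(wordPos w k, wordPos w (k + 1))) n).symm
    _ = ∏ k : Fin n, (if (w k).1 = 2 then t else p) := by
        refine Finset.prod_congr rfl fun k _ => ?_
        rw [hlvl, wordPos_succ w k.2, vert_iff, Fin.eta]
        split_ifs <;> rfl

/-- The weight `∏ₖ lvl(wₖ)` of a word equals `p^{h} t^{n-h}`, `h` its number of horizontal
letters. -/
theorem prod_ite_eq {n : ℕ} (w : Fin n → Fin 3 × Bool) (p t : ℝ) :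
    ∏ k : Fin n, (if (w k).1 = 2 then t else p) =
      p ^ (Finset.univ.filter fun k => (w k).1 ≠ 2).card *
        t ^ (n - (Finset.univ.filter fun k => (w k).1 ≠ 2).card) := by
  rw [Finset.prod_ite, Finset.prod_const, Finset.prod_const, mul_comm]
  have h := Finset.card_filter_add_card_filter_not (s := (Finset.univ : Finset (Fin n)))
    (fun k => (w k).1 = 2)
  rw [Finset.card_univ, Fintype.card_fin] at h
  simp only [ne_eq]
  congr 1
  congr 1
  omega

/-! ### Counting words with constant vertical runs (the binomial code) -/

/-- **Fibre bound.** Among words whose consecutive vertical letters agree, those with a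
prescribed set `A` of horizontal positions number at most `2 · 8^{|A|}`: such a word is
determined by its horizontal letters (`4` choices each), the direction of the letter following
each horizontal position (`2` choices each) and the direction of its first letter. -/
theorem fiber_card_le {n : ℕ} (good : Finset (Fin n → Fin 3 × Bool))
    (hgood : ∀ w ∈ good, ∀ (j : ℕ) (hj : j + 1 < n),
      (w ⟨j, Nat.lt_of_succ_lt hj⟩).1 = 2 → (w ⟨j + 1, hj⟩).1 = 2 →
        w ⟨j, Nat.lt_of_succ_lt hj⟩ = w ⟨j + 1, hj⟩)
    (A : Finset (Fin n)) :
    ((good.filter fun w => (Finset.univ.filter fun k => (w k).1 ≠ 2) = A).card : ℝ) ≤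
      2 * 8 ^ A.card := by
  classical
  have hletter : ∀ a b : Fin 3 × Bool, a.1 ≠ 2 → b.1 ≠ 2 →
      (decide (a.1 = 0), a.2) = (decide (b.1 = 0), b.2) → a = b := by decide
  obtain ⟨code, hcode⟩ :
      ∃ code : (Fin n → Fin 3 × Bool) → (A → Bool × Bool) × (A → Bool) × Bool,
        ∀ w, code w =
          (fun k => (decide ((w k.1).1 = 0), (w k.1).2),
            fun k => if h : k.1.1 + 1 < n then (w ⟨k.1.1 + 1, h⟩).2 else false,
            if h : 0 < n then (w ⟨0, h⟩).2 else false) :=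
    ⟨_, fun _ => rfl⟩
  set S := good.filter fun w => (Finset.univ.filter fun k => (w k).1 ≠ 2) = A with hS
  have hinj : Set.InjOn code ↑S := by
    intro w hw w' hw' heq
    rw [hS, Finset.coe_filter, mem_setOf_eq] at hw hw'
    have hA : ∀ k : Fin n, k ∈ A ↔ (w k).1 ≠ 2 := fun k => by rw [← hw.2]; simp
    have hA' : ∀ k : Fin n, k ∈ A ↔ (w' k).1 ≠ 2 := fun k => by rw [← hw'.2]; simp
    rw [hcode, hcode, Prod.mk.injEq, Prod.mk.injEq] at heq
    obtain ⟨c1, c2, c3⟩ := heq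
    suffices H : ∀ (k : ℕ) (hk : k < n), w ⟨k, hk⟩ = w' ⟨k, hk⟩ from
      funext fun k => H k.1 k.2
    intro k
    induction k with
    | zero =>
      intro hk
      by_cases hkA : (⟨0, hk⟩ : Fin n) ∈ A
      · exact hletter _ _ ((hA _).1 hkA) ((hA' _).1 hkA) (congrFun c1 ⟨_, hkA⟩)
      · have e1 : (w ⟨0, hk⟩).1 = 2 := by by_contra h; exact hkA ((hA _).2 h)
        have e1' : (w' ⟨0, hk⟩).1 = 2 := by by_contra h; exact hkA ((hA' _).2 h)
        have e2 : (w ⟨0, hk⟩).2 = (w' ⟨0, hk⟩).2 := by simpa [hk] using c3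
        exact Prod.ext (e1.trans e1'.symm) e2
    | succ j ih =>
      intro hk
      by_cases hkA : (⟨j + 1, hk⟩ : Fin n) ∈ A
      · exact hletter _ _ ((hA _).1 hkA) ((hA' _).1 hkA) (congrFun c1 ⟨_, hkA⟩)
      · have e1 : (w ⟨j + 1, hk⟩).1 = 2 := by by_contra h; exact hkA ((hA _).2 h)
        have e1' : (w' ⟨j + 1, hk⟩).1 = 2 := by by_contra h; exact hkA ((hA' _).2 h)
        by_cases hjA : (⟨j, Nat.lt_of_succ_lt hk⟩ : Fin n) ∈ A
        · have e2 := congrFun c2 ⟨_, hjA⟩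
          simp [hk] at e2
          exact Prod.ext (e1.trans e1'.symm) e2
        · have f1 : (w ⟨j, Nat.lt_of_succ_lt hk⟩).1 = 2 := by
            by_contra h; exact hjA ((hA _).2 h)
          have f1' : (w' ⟨j, Nat.lt_of_succ_lt hk⟩).1 = 2 := by
            by_contra h; exact hjA ((hA' _).2 h)
          rw [← hgood w hw.1 j hk f1 e1, ← hgood w' hw'.1 j hk f1' e1']
          exact ih _
  have hmaps : Set.MapsTo code ↑S
      ↑(Finset.univ : Finset ((A → Bool × Bool) × (A → Bool) × Bool)) :=
    fun w _ => Finset.mem_coe.2 (Finset.mem_univ _)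
  have hcard := Finset.card_le_card_of_injOn code hmaps hinj
  simp only [Finset.card_univ, Fintype.card_prod, Fintype.card_fun, Fintype.card_bool,
    Fintype.card_coe] at hcard
  calc (S.card : ℝ) ≤ ((2 * 2) ^ A.card * (2 ^ A.card * 2) : ℕ) := by exact_mod_cast hcard
    _ = 2 * 8 ^ A.card := by
        rw [show (8 : ℝ) = 2 * 2 * 2 by norm_num, mul_pow (2 * 2 : ℝ) 2]
        push_cast
        ring

/-- **The binomial code.** For a set of words with constant vertical runs, the total weight
`∑_w p^{h(w)} t^{n-h(w)}` is at most `∑_A 2 · 8^{|A|} p^{|A|} t^{n-|A|} = 2 (8p + t)ⁿ`. -/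
theorem sum_weight_le {n : ℕ} {p t : ℝ} (hp : 0 ≤ p) (ht : 0 ≤ t)
    (good : Finset (Fin n → Fin 3 × Bool))
    (hgood : ∀ w ∈ good, ∀ (j : ℕ) (hj : j + 1 < n),
      (w ⟨j, Nat.lt_of_succ_lt hj⟩).1 = 2 → (w ⟨j + 1, hj⟩).1 = 2 →
        w ⟨j, Nat.lt_of_succ_lt hj⟩ = w ⟨j + 1, hj⟩) :
    ∑ w ∈ good, p ^ (Finset.univ.filter fun k => (w k).1 ≠ 2).card *
        t ^ (n - (Finset.univ.filter fun k => (w k).1 ≠ 2).card) ≤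
      2 * (8 * p + t) ^ n := by
  classical
  have hfib := Finset.sum_fiberwise' good (fun w => Finset.univ.filter fun k => (w k).1 ≠ 2)
    (fun A => p ^ A.card * t ^ (n - A.card))
  rw [← hfib, ← Fin.sum_pow_mul_eq_add_pow, Finset.mul_sum]
  refine Finset.sum_le_sum fun A _ => ?_
  rw [Finset.sum_const, nsmul_eq_mul]
  calc ((good.filter fun w => (Finset.univ.filter fun k => (w k).1 ≠ 2) = A).card : ℝ) *
        (p ^ A.card * t ^ (n - A.card))
      ≤ (2 * 8 ^ A.card) * (p ^ A.card * t ^ (n - A.card)) :=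
        mul_le_mul_of_nonneg_right (fiber_card_le good hgood A) (by positivity)
    _ = 2 * ((8 * p) ^ A.card * t ^ (n - A.card)) := by rw [mul_pow]; ring

/-! ### Assembly: `μ{0 percolates} ≤ 2 (8p + t)ⁿ` for every `n` -/

/-- **Path counting with vertical runs.** For a label-driven configuration `cfg U ⊆ E(𝕃³)`
whose word cylinders have probability at most `∏ₖ lvl(wₖ)`, the probability that the origin
percolates is at most `2 (8p + t)ⁿ` for every `n`. -/
theorem real_percolates_le (n : ℕ) {p t : ℝ} (hp0 : 0 ≤ p) (ht0 : 0 ≤ t)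
    (cfg : (Sym2 (Site 3) → ℝ) → Set (Sym2 (Site 3)))
    (hE : ∀ U, cfg U ⊆ (zdGraph 3).edgeSet)
    (hcyl : ∀ w : Fin n → Fin 3 × Bool,
      ((Finset.range n).image fun k => s(wordPos w k, wordPos w (k + 1))).card = n →
        (labelMeasure (Site 3)).real
            {U | (↑((Finset.range n).image fun k => s(wordPos w k, wordPos w (k + 1))) :
              Set (Sym2 (Site 3))) ⊆ cfg U} ≤
          ∏ k : Fin n, (if (w k).1 = 2 then t else p)) :
    (labelMeasure (Site 3)).real {U | cfg U ∈ percolatesAt (0 : Site 3)} ≤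
      2 * (8 * p + t) ^ n := by
  classical
  have := isProbabilityMeasure_labelMeasure (Site 3)
  obtain ⟨E, hEw⟩ : ∃ E : (Fin n → Fin 3 × Bool) → Finset (Sym2 (Site 3)),
      ∀ w, E w = (Finset.range n).image fun k => s(wordPos w k, wordPos w (k + 1)) :=
    ⟨_, fun _ => rfl⟩
  set good : Finset (Fin n → Fin 3 × Bool) :=
    Finset.univ.filter fun w => (E w).card = n with hgood
  have hsub : {U | cfg U ∈ percolatesAt (0 : Site 3)} ⊆
      ⋃ w ∈ good, {U | (↑(E w) : Set (Sym2 (Site 3))) ⊆ cfg U} := by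
    intro U hU
    obtain ⟨w, hw, hwU⟩ := exists_openWord_of_infinite (hE U) hU n
    refine Set.mem_biUnion (x := w) ?_ ?_
    · rw [hgood, Finset.coe_filter]
      exact ⟨Finset.mem_univ _, by rw [hEw]; exact hw⟩
    · show (↑(E w) : Set (Sym2 (Site 3))) ⊆ cfg U
      rw [hEw]
      exact hwU
  have hgood' : ∀ w ∈ good, ∀ (j : ℕ) (hj : j + 1 < n),
      (w ⟨j, Nat.lt_of_succ_lt hj⟩).1 = 2 → (w ⟨j + 1, hj⟩).1 = 2 →
        w ⟨j, Nat.lt_of_succ_lt hj⟩ = w ⟨j + 1, hj⟩ := by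
    intro w hw j hj h1 h2
    rw [hgood, Finset.mem_filter, hEw] at hw
    exact letter_eq_of_card w hw.2 j hj h1 h2
  calc (labelMeasure (Site 3)).real {U | cfg U ∈ percolatesAt (0 : Site 3)}
      ≤ (labelMeasure (Site 3)).real
          (⋃ w ∈ good, {U | (↑(E w) : Set (Sym2 (Site 3))) ⊆ cfg U}) :=
        measureReal_mono hsub (measure_ne_top _ _)
    _ ≤ ∑ w ∈ good,
          (labelMeasure (Site 3)).real {U | (↑(E w) : Set (Sym2 (Site 3))) ⊆ cfg U} :=
        measureReal_biUnion_finset_le _ _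
    _ ≤ ∑ w ∈ good, p ^ (Finset.univ.filter fun k => (w k).1 ≠ 2).card *
          t ^ (n - (Finset.univ.filter fun k => (w k).1 ≠ 2).card) := by
        refine Finset.sum_le_sum fun w hw => ?_
        rw [hgood, Finset.mem_filter, hEw] at hw
        refine le_of_le_of_eq ?_ (prod_ite_eq w p t)
        rw [hEw]
        exact hcyl w hw.2
    _ ≤ 2 * (8 * p + t) ^ n := sum_weight_le hp0 ht0 good hgood'

end RunBound

/-- **stub `stub_runBound` (registered)** — no percolation when `8p < 1 - t`: for the label-driven
anisotropic configuration on `ℤ² × ℤ` (vertical bonds open iff `U_e ≤ t`, horizontal iff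
`U_e ≤ p`), `μ{0 percolates} = 0` whenever `0 ≤ t < 1`, `0 ≤ p`, `8p < 1 - t`
(path counting with vertical runs: `μ{0 percolates} ≤ 2 (8p + t)ⁿ → 0`). -/
theorem stub_runBound : ∀ t p : ℝ, 0 ≤ t → t < 1 → 0 ≤ p → 8 * p < 1 - t → (labelMeasure (Site 3)).real {U | {e | e ∈ (zdGraph 3).edgeSet ∧ (((∃ x : Site 3, e = s(x, x + Pi.single (2 : Fin 3) 1)) ∧ U e ≤ t) ∨ (¬ (∃ x : Site 3, e = s(x, x + Pi.single (2 : Fin 3) 1)) ∧ U e ≤ p))} ∈ percolatesAt (0 : Site 3)} = 0 := by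
  intro t p ht0 ht1 hp0 hpt
  have hp1 : p ≤ 1 := by linarith
  have hq0 : 0 ≤ 8 * p + t := by linarith
  have hq1 : 8 * p + t < 1 := by linarith
  have hlim : Filter.Tendsto (fun n : ℕ => 2 * (8 * p + t) ^ n) Filter.atTop (nhds 0) := by
    simpa using (tendsto_pow_atTop_nhds_zero_of_lt_one hq0 hq1).const_mul 2
  refine le_antisymm (ge_of_tendsto' hlim fun n => ?_) measureReal_nonneg
  exact RunBound.real_percolates_le n hp0 ht0
    (fun U => {e | e ∈ (zdGraph 3).edgeSet ∧
      (((∃ x : Site 3, e = s(x, x + Pi.single (2 : Fin 3) 1)) ∧ U e ≤ t) ∨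
        (¬ (∃ x : Site 3, e = s(x, x + Pi.single (2 : Fin 3) 1)) ∧ U e ≤ p))})
    (fun U e he => he.1) (fun w hw => RunBound.cylinder_le hp0 hp1 ht0 ht1.le w hw)

end Summit.CriticalPhenomena.PercolationContinuityZ3.Cruxes.CriticalCurveRegular.Locmod

end
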